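import Summits.BirchSwinnertonDyer.Rank1Residual.Additive.CyclotomicTowerGlobalTorsion
import Summits.BirchSwinnertonDyer.Rank1Residual.X11b.AnticyclotomicStrictDescent
import HarnessLib

/-!
# Kobayashi's Lemma 9.1 at a good supersingular prime, H¹-level: the restrictions
# `H¹(K₀K_m, E[p^∞]) → H¹(K₀K_n, E[p^∞]) → H¹(K₀K_∞, E[p^∞])` are INJECTIVE (inflation–restriction
# with `E(K₀K_n)[p^∞] = E(K₀K_∞)[p^∞] = 0`, file 12) — cell `b2b-bsdres`, CLASS-CLOSURE lane, class
# O10 — x1b GEN 32, class lead; file 13 of the local series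

HONEST FRAMING (cell `b2b-bsdres`, run/shared/lean/b2b/bsd-rank1-residual/, verbatim in every
file): the goal of the cell is to DELETE the COMBINATION-SHAPED residual classes of the
Birch–Swinnerton-Dyer formula for ALL analytic-rank `≤ 1` elliptic curves over `ℚ` — "full BSD
formula for every rank `≤ 1` curve in class `C`" assembled STRICTLY from published theorems — so
that the rank-`≤ 1` remainder becomes exactly the CONSTRUCTION-SHAPED classes, which are TYPED
(missing-input `Prop`s), NOT attempted. This is not "finishing BSD". CLASS-CLOSURE lane: prove
what is provable now; shrink each hard class to its core with data; no claim beyond stated classes;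
research routes on CONSTRUCTION-SHAPED X12 / O10; census / instrument output = EVIDENCE / conjecture
items, NEVER a Literature fact; `RESIDUAL-MAP.md` marks change only by signed lines. THIS FILE:
TOOL THEOREMS ONLY (X11b's generic `AcSelmer.resOfLe_injective_of_fixedPoints` — inflation–restriction
with trivial fixed part — fed with file 12's vanishing) — no definition, no named Literature fact,
no Summits-side fact `def`, no `sorry`, axioms standard; nothing is booked; no label / mark / count /
sub-cell moves; O10 stays OPEN / CONSTRUCTION-SHAPED; nothing about `BSD(W, p)` of any pair is
claimed.

## What is proved

`E = ℚ_p`, `K` a number field with `K → ℚ_p`, `K₀/K` Galois of degree `< (p² − 1)/2` (Kobayashi: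
`K = ℚ`, `K₀ = ℚ(μ_p)`), `p ≥ 3`, `W/K` with `W ⊗ ℚ̄_p = V ⊗ ℚ̄_p` for `V/ℚ` elliptic, globally
minimal, `V.HasGoodReductionAtPrime p`, `V.frobeniusTrace p = 0` (or directly a good supersingular
`ℤ_p`-model `M`):

* **`resOfLe_towerTopSubgroup_injective_padic` / `…_of_goodSupersingular`** — the restriction
  `H¹(Gal(K̄/K₀K_n), E[p^∞]) → H¹(Gal(K̄/K₀K_∞), E[p^∞])` (`W.resOfLe p (towerTopSubgroup_le κ K₀ n)`)
  is INJECTIVE for every `n` — [K] Lemma 9.1 ("the restriction map `Sel(E/K_n) → Sel(E/K_∞)` is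
  injective", through `H¹(K_∞/K_n, E(K_∞)[p^∞]) = 0`), on cc-typer-6's objects
  (`W.subgroupH1 p (towerSubgroup κ K₀ n)` ⊇ `towerSignedSelmer…`), hence on every Selmer-type
  subgroup; in particular the bottom-layer control map `a : Sel_str(W/ℚ)[p^∞] → (Sel⁻(V/K_∞)^η)^Γ`
  of the (C3_η) count is injective.
* `resOfLe_towerSubgroup_injective_padic` / `…_of_goodSupersingular` — the same between layers
  `m ≤ n`: `H¹(Gal(K̄/K₀K_m), E[p^∞]) ↪ H¹(Gal(K̄/K₀K_n), E[p^∞])`.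

References: [Kobayashi2003] Lemma 9.1 (p. 25), Prop. 8.7 (p. 16); [GreenbergLNM1716] §3 Lemma 3.1
(p. 86); [SerreGaloisCohomology1997] I.§2.6 (b).
-/

noncomputable section

open scoped Classical

namespace Summit.BirchSwinnertonDyer.Rank1Residual.Additive

open Literature.NumberTheory.EllipticCurves Literature.NumberTheory.GaloisRepresentations
  Literature.NumberTheory.EllipticCurves.Kobayashi2003 ZpExtension WeierstrassCurve
  Summit.BirchSwinnertonDyer.Rank1Residual.X11b

section Padic

variable {p : ℕ} [hp : Fact p.Prime] {K : Type} [Field K] [Algebra K ℚ_[p]] (κ : ZpExtension K p)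
  (K₀ : Type) [Field K₀] [NumberField K₀] [Algebra K K₀] [(galRange (K := K) K₀).Normal]
  (ι : AlgebraicClosure K →ₐ[K] AlgebraicClosure ℚ_[p]) (W : WeierstrassCurve K) [W.IsElliptic]

include ι in
/-- **[K] Lemma 9.1, H¹-level, from a good supersingular `ℤ_p`-model**: the restriction
`H¹(Gal(K̄/K₀K_n), E[p^∞]) → H¹(Gal(K̄/K₀K_∞), E[p^∞])` is injective (inflation–restriction: its
kernel is `H¹(K₀K_∞/K₀K_n, E[p^∞]^{Gal(K̄/K₀K_∞)})` and the fixed part vanishes by file 12's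
`fixedPoints_towerTopSubgroup_geomPrimaryTorsion_eq_bot_padic`; X11b's generic
`AcSelmer.resOfLe_injective_of_fixedPoints`). [cite: Kobayashi2003, Lemma 9.1 (p. 25), Prop. 8.7 (p. 16)]
[cite: GreenbergLNM1716, §3 Lemma 3.1 (p. 86)] -/
theorem resOfLe_towerTopSubgroup_injective_padic (hp2 : p ≠ 2)
    (M : WeierstrassCurve ℤ_[p]) (hΔ : IsUnit M.Δ)
    (hA : M.hasseCoeff p ∈ IsLocalRing.maximalIdeal ℤ_[p])
    (hWM : M.baseChange (AlgebraicClosure ℚ_[p]) = W.baseChange (AlgebraicClosure ℚ_[p]))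
    (hK₀0 : (galRange (K := K) K₀).index ≠ 0) (hK₀ : (galRange (K := K) K₀).index < (p ^ 2 - 1) / 2)
    (n : ℕ) :
    Function.Injective (W.resOfLe p (towerTopSubgroup_le κ K₀ n)) := by
  have hbot := fixedPoints_towerTopSubgroup_geomPrimaryTorsion_eq_bot_padic κ K₀ ι W hp2 M hΔ hA hWM
    hK₀0 hK₀
  refine AcSelmer.resOfLe_injective_of_fixedPoints (towerTopSubgroup_le κ K₀ n) inferInstance
    (W.continuous_smul_geomPrimaryTorsion p) fun m hm ↦ ?_
  have hmem : m ∈ FixedPoints.addSubgroup (towerTopSubgroup κ K₀) (geomPrimaryTorsion W p) := by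
    rw [FixedPoints.mem_addSubgroup]
    rintro ⟨σ, hσ⟩
    rw [Subgroup.mk_smul]
    exact hm σ hσ
  rw [hbot] at hmem
  exact AddSubgroup.mem_bot.mp hmem

omit [NumberField K₀] in
include ι in
/-- **Restriction between layers is injective**: `H¹(Gal(K̄/K₀K_m), E[p^∞]) ↪ H¹(Gal(K̄/K₀K_n), E[p^∞])`
for `m ≤ n` (fixed part `E(K₀K_n)[p^∞] = 0`, file 12's layer form).
[cite: Kobayashi2003, Lemma 9.1 (p. 25), Prop. 8.7 (p. 16)] [cite: GreenbergLNM1716, §3 Lemma 3.1 (p. 86)] -/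
theorem resOfLe_towerSubgroup_injective_padic (hp2 : p ≠ 2)
    (M : WeierstrassCurve ℤ_[p]) (hΔ : IsUnit M.Δ)
    (hA : M.hasseCoeff p ∈ IsLocalRing.maximalIdeal ℤ_[p])
    (hWM : M.baseChange (AlgebraicClosure ℚ_[p]) = W.baseChange (AlgebraicClosure ℚ_[p]))
    (hK₀0 : (galRange (K := K) K₀).index ≠ 0) (hK₀ : (galRange (K := K) K₀).index < (p ^ 2 - 1) / 2)
    {m n : ℕ} (hmn : m ≤ n) :
    Function.Injective (W.resOfLe p (towerSubgroup_antitone κ K₀ hmn)) := by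
  refine AcSelmer.resOfLe_injective_of_fixedPoints (towerSubgroup_antitone κ K₀ hmn) inferInstance
    (W.continuous_smul_geomPrimaryTorsion p) fun x hx ↦ ?_
  obtain ⟨k, hk⟩ := x.2
  have hP : ∀ σ ∈ towerSubgroup κ K₀ n, σ • ((x : geomPrimaryTorsion W p) : geomPoints W) =
      ((x : geomPrimaryTorsion W p) : geomPoints W) := by
    intro σ hσ
    rw [← primaryComponent.coe_smul, hx σ hσ]
  exact Subtype.ext (eq_zero_of_prime_pow_smul_eq_zero_of_forall_towerSubgroup_smul_eq_padic κ K₀ ι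
    W hp2 M hΔ hA hWM hK₀0 hK₀ n k hP hk)

variable [NumberField K] [IsGalois K K₀]

include ι in
/-- **[K] Lemma 9.1 (H¹-level) for a globally minimal good supersingular `V/ℚ` read over `K`**:
`H¹(Gal(K̄/K₀K_n), E[p^∞]) → H¹(Gal(K̄/K₀K_∞), E[p^∞])` is injective for every `n`, given
`W ⊗ ℚ̄_p = V ⊗ ℚ̄_p`, `V.HasGoodReductionAtPrime p`, `V.frobeniusTrace p = 0`, `K₀/K` Galois of
degree `< (p² − 1)/2`, `p ≥ 3` — NO torsion / model hypothesis.
[cite: Kobayashi2003, Lemma 9.1 (p. 25), Prop. 8.7 (p. 16)] -/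
theorem resOfLe_towerTopSubgroup_injective_of_goodSupersingular (hp2 : p ≠ 2)
    (V : WeierstrassCurve ℚ) [V.IsElliptic] [V.IsGloballyMinimal]
    (hgood : V.HasGoodReductionAtPrime p) (hap : V.frobeniusTrace p = 0)
    (hWV : W.baseChange (AlgebraicClosure ℚ_[p]) = V.baseChange (AlgebraicClosure ℚ_[p]))
    (hK₀ : Module.finrank K K₀ < (p ^ 2 - 1) / 2) (n : ℕ) :
    Function.Injective (W.resOfLe p (towerTopSubgroup_le κ K₀ n)) := by
  obtain ⟨M, hΔ, hA, hVM⟩ := exists_goodSupersingularPadicModel hp2 V hgood hap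
  obtain ⟨hK₀0, hK₀'⟩ := index_galRange_ne_zero_and_lt (p := p) K₀ hK₀
  exact resOfLe_towerTopSubgroup_injective_padic κ K₀ ι W hp2 M hΔ hA (hVM.trans hWV.symm) hK₀0
    hK₀' n

include ι in
/-- **Restriction between layers is injective, for a globally minimal good supersingular `V/ℚ` read
over `K`** (`m ≤ n`; same hypotheses). [cite: Kobayashi2003, Lemma 9.1 (p. 25), Prop. 8.7 (p. 16)] -/
theorem resOfLe_towerSubgroup_injective_of_goodSupersingular (hp2 : p ≠ 2)
    (V : WeierstrassCurve ℚ) [V.IsElliptic] [V.IsGloballyMinimal]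
    (hgood : V.HasGoodReductionAtPrime p) (hap : V.frobeniusTrace p = 0)
    (hWV : W.baseChange (AlgebraicClosure ℚ_[p]) = V.baseChange (AlgebraicClosure ℚ_[p]))
    (hK₀ : Module.finrank K K₀ < (p ^ 2 - 1) / 2) {m n : ℕ} (hmn : m ≤ n) :
    Function.Injective (W.resOfLe p (towerSubgroup_antitone κ K₀ hmn)) := by
  obtain ⟨M, hΔ, hA, hVM⟩ := exists_goodSupersingularPadicModel hp2 V hgood hap
  obtain ⟨hK₀0, hK₀'⟩ := index_galRange_ne_zero_and_lt (p := p) K₀ hK₀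
  exact resOfLe_towerSubgroup_injective_padic κ K₀ ι W hp2 M hΔ hA (hVM.trans hWV.symm) hK₀0 hK₀'
    hmn

end Padic

end Summit.BirchSwinnertonDyer.Rank1Residual.Additive

end
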